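import Mathlib
import HarnessLib.Audit
import Summits.PneNP.PneNP.Theorems.PstarCoreBoundTargets

/-!
# Swapping the AND slots of an output: "w.l.o.g. the gated variable sits in slot 2" (ROUND-24, infrastructure for the O2 slices)

FRONTIER range-avoidance ladder, rung F-N3, ROUND 24 (cell `pnp-ideate`; restricted-model proof complexity — nothing here bears on `P` versus `NP`).

The typed O2 statements (`PstarFreshErase.FreshGate`, `PstarFreshEraseGates.card_le_five_of_freshGates`, …) put the touched chord variable in AND slot
`2` of the monomial.  Since `x₂ x₃ = x₃ x₂`, exchanging the two AND slots of one output `g` of a pure typed instance changes nothing observable: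

* `swapAnd I g` — the instance with slots `2, 3` of output `g` exchanged; `swapAnd_vars_*`;
* invariance: `isPure_swapAnd`, `typed_swapAnd`, `eval_swapAnd`, `varSet_swapAnd`, `bdry_swapAnd`, `boundaryExpanding_swapAnd`, `simpleOverlap_swapAnd`,
  `gval_swapAnd`, `privs_swapAnd`, `isChord_swapAnd`, `xorClosed_swapAnd`, `peelable_swapAnd`, `terminal_swapAnd`.

So any hypothesis "slot 2" can be met by passing to `swapAnd I g`, all terminal-core data being preserved.
-/

set_option linter.dupNamespace false -- `Summit.PneNP.PneNP.…`: summit = sub-problem name (D-0017 single-conjunct layout)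

open Finset Literature.Computability.Complexity
open Summit.PneNP.PneNP.Theorems.PstarFibrePolys (bit bit_injective)
open Summit.PneNP.PneNP.Theorems.PstarTyped (Typed)
open Summit.PneNP.PneNP.Theorems.PstarSALevel (varSet bdry BoundaryExpanding SimpleOverlap)
open Summit.PneNP.PneNP.Theorems.PstarGapPeeling (eval_pure)
open Summit.PneNP.PneNP.Theorems.PstarGapOneAll (gval)
open Summit.PneNP.PneNP.Theorems.PstarGConstraint (bit_gval)
open Summit.PneNP.PneNP.Theorems.PstarCoreBound (XorClosed)
open Summit.PneNP.PneNP.Theorems.PstarChordRepair (IsChord)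
open Summit.PneNP.PneNP.Theorems.PstarChordBridgeCotree (Peelable)
open Summit.PneNP.PneNP.Theorems.PstarChordBridgeTools (privs mem_privs xpdeg)
open Summit.PneNP.PneNP.Theorems.PstarCoreBoundTargets (Terminal)

namespace Summit.PneNP.PneNP.Theorems.PstarSlotSwap

variable {n m : ℕ}

/-- the transposition of the two AND slots -/
def σ : Equiv.Perm (Fin 4) := Equiv.swap 2 3

/-- Values of `σ`. -/
theorem σ_apply (s : Fin 4) : σ s = if s = 2 then 3 else if s = 3 then 2 else s := by
  unfold σ
  fin_cases s <;> decide

/-- `σ` fixes the XOR slots. -/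
theorem σ_of_lt {s : Fin 4} (hs : s.val < 2) : σ s = s := by
  rw [σ_apply]
  have : s ≠ 2 ∧ s ≠ 3 := by
    constructor <;> (rintro rfl; simp at hs)
  rw [if_neg this.1, if_neg this.2]

/-- `σ` preserves being an AND slot. -/
theorem two_le_σ_iff (s : Fin 4) : 2 ≤ (σ s).val ↔ 2 ≤ s.val := by
  rw [σ_apply]
  fin_cases s <;> simp

/-- **The instance with the AND slots of output `g` exchanged.** -/
def swapAnd (I : LocalMap 4 n m) (g : Fin m) : LocalMap 4 n m where
  vars j s := if j = g then I.vars j (σ s) else I.vars j s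
  table := I.table

/-- Other outputs are unchanged. -/
theorem swapAnd_vars_of_ne (I : LocalMap 4 n m) {g j : Fin m} (h : j ≠ g) (s : Fin 4) : (swapAnd I g).vars j s = I.vars j s := by
  show (if j = g then _ else _) = _
  rw [if_neg h]

/-- The swapped output reads slot `σ s`. -/
theorem swapAnd_vars_self (I : LocalMap 4 n m) (g : Fin m) (s : Fin 4) : (swapAnd I g).vars g s = I.vars g (σ s) := by
  show (if g = g then _ else _) = _
  rw [if_pos rfl]

/-- General slot formula. -/
theorem swapAnd_vars (I : LocalMap 4 n m) (g j : Fin m) (s : Fin 4) : (swapAnd I g).vars j s = I.vars j (if j = g then σ s else s) := by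
  by_cases h : j = g
  · subst h; rw [swapAnd_vars_self, if_pos rfl]
  · rw [swapAnd_vars_of_ne I h, if_neg h]

/-- XOR slots are unchanged. -/
theorem swapAnd_vars_xor (I : LocalMap 4 n m) (g j : Fin m) {s : Fin 4} (hs : s.val < 2) : (swapAnd I g).vars j s = I.vars j s := by
  rw [swapAnd_vars]
  split_ifs
  · rw [σ_of_lt hs]
  · rfl

/-- The AND slots of `g` are exchanged. -/
theorem swapAnd_vars_two (I : LocalMap 4 n m) (g : Fin m) : (swapAnd I g).vars g 2 = I.vars g 3 ∧ (swapAnd I g).vars g 3 = I.vars g 2 := by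
  rw [swapAnd_vars_self, swapAnd_vars_self]
  exact ⟨rfl, rfl⟩

/-- The AND PAIR of every output is the same set. -/
theorem swapAnd_andPair (I : LocalMap 4 n m) (g j : Fin m) (v : Fin n) :
    ((swapAnd I g).vars j 2 = v ∨ (swapAnd I g).vars j 3 = v) ↔ (I.vars j 2 = v ∨ I.vars j 3 = v) := by
  by_cases h : j = g
  · subst h; rw [(swapAnd_vars_two I j).1, (swapAnd_vars_two I j).2]; exact Or.comm
  · rw [swapAnd_vars_of_ne I h, swapAnd_vars_of_ne I h]

/-! ## Invariance -/

/-- Purity is preserved. -/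
theorem isPure_swapAnd {I : LocalMap 4 n m} (hI : I.IsPure xorAndPred) (g : Fin m) : (swapAnd I g).IsPure xorAndPred := by
  refine ⟨fun j => hI.1 j, fun j s t h => ?_⟩
  rw [swapAnd_vars, swapAnd_vars] at h
  have h' := hI.2 j h
  by_cases hj : j = g
  · rw [if_pos hj, if_pos hj] at h'; exact σ.injective h'
  · rw [if_neg hj, if_neg hj] at h'; exact h'

/-- Typedness is preserved. -/
theorem typed_swapAnd {I : LocalMap 4 n m} (hT : Typed I) (g : Fin m) : Typed (swapAnd I g) := by
  intro j j' s s' hs hs'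
  rw [swapAnd_vars_xor I g j hs, swapAnd_vars]
  refine hT j j' s _ hs ?_
  split_ifs
  · exact (two_le_σ_iff s').2 hs'
  · exact hs'

/-- Evaluation is unchanged (the AND is commutative). -/
theorem eval_swapAnd {I : LocalMap 4 n m} (hI : I.IsPure xorAndPred) (g : Fin m) (x : Fin n → Bool) (j : Fin m) :
    (swapAnd I g).eval x j = I.eval x j := by
  rw [eval_pure _ (isPure_swapAnd hI g), eval_pure I hI, swapAnd_vars_xor I g j (by decide : (0 : Fin 4).val < 2),
    swapAnd_vars_xor I g j (by decide : (1 : Fin 4).val < 2)]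
  by_cases h : j = g
  · subst h; rw [(swapAnd_vars_two I j).1, (swapAnd_vars_two I j).2, Bool.and_comm]
  · rw [swapAnd_vars_of_ne I h, swapAnd_vars_of_ne I h]

/-- Variable sets are unchanged. -/
theorem varSet_swapAnd (I : LocalMap 4 n m) (g j : Fin m) : varSet (swapAnd I g) j = varSet I j := by
  classical
  unfold PstarSALevel.varSet
  ext v
  simp only [mem_image, mem_univ, true_and]
  constructor
  · rintro ⟨s, hs⟩
    rw [swapAnd_vars] at hs
    exact ⟨_, hs⟩
  · rintro ⟨s, hs⟩
    refine ⟨if j = g then σ s else s, ?_⟩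
    rw [swapAnd_vars]
    by_cases h : j = g
    · rw [if_pos h, if_pos h]
      show I.vars j (σ (σ s)) = v
      rw [show σ (σ s) = s from by unfold σ; exact Equiv.swap_apply_self _ _ _]
      exact hs
    · rw [if_neg h, if_neg h]; exact hs

/-- Boundaries are unchanged. -/
theorem bdry_swapAnd (I : LocalMap 4 n m) (g : Fin m) (J : Finset (Fin m)) : bdry (swapAnd I g) J = bdry I J := by
  classical
  unfold PstarSALevel.bdry
  simp only [varSet_swapAnd]

/-- Expansion is preserved. -/
theorem boundaryExpanding_swapAnd {I : LocalMap 4 n m} {r : ℕ} (hB : BoundaryExpanding r I) (g : Fin m) : BoundaryExpanding r (swapAnd I g) := by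
  intro J hJ
  rw [bdry_swapAnd]
  exact hB J hJ

/-- Simple overlaps are preserved. -/
theorem simpleOverlap_swapAnd {I : LocalMap 4 n m} (hS : SimpleOverlap I) (g : Fin m) : SimpleOverlap (swapAnd I g) := by
  intro j j' h
  rw [varSet_swapAnd, varSet_swapAnd]
  exact hS j j' h

/-- G-constraints are unchanged (the monomial is commutative). -/
theorem gval_swapAnd (I : LocalMap 4 n m) (g : Fin m) (C : Finset (Fin n)) (G : Finset (Fin m)) (x : Fin n → Bool) :
    gval (swapAnd I g) C G x = gval I C G x := by
  apply bit_injective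
  rw [bit_gval, bit_gval]
  congr 1
  refine sum_congr rfl fun j _ => ?_
  by_cases h : j = g
  · subst h; rw [(swapAnd_vars_two I j).1, (swapAnd_vars_two I j).2, mul_comm]
  · rw [swapAnd_vars_of_ne I h, swapAnd_vars_of_ne I h]

/-- Privates are unchanged. -/
theorem privs_swapAnd (I : LocalMap 4 n m) (g : Fin m) (N : Finset (Fin m)) : privs (swapAnd I g) N = privs I N := by
  ext v
  rw [mem_privs, mem_privs]
  simp only [swapAnd_andPair]

/-- Chords are unchanged. -/
theorem isChord_swapAnd (I : LocalMap 4 n m) (g : Fin m) (J : Finset (Fin m)) (e : Fin m) : IsChord (swapAnd I g) J e ↔ IsChord I J e := by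
  unfold PstarChordRepair.IsChord
  rw [bdry_swapAnd]
  by_cases h : e = g
  · subst h; rw [(swapAnd_vars_two I e).1, (swapAnd_vars_two I e).2]; exact And.comm
  · rw [swapAnd_vars_of_ne I h, swapAnd_vars_of_ne I h]

/-- XOR-closure is unchanged. -/
theorem xorClosed_swapAnd (I : LocalMap 4 n m) (g : Fin m) (J : Finset (Fin m)) : XorClosed (swapAnd I g) J ↔ XorClosed I J := by
  unfold PstarCoreBound.XorClosed
  rw [bdry_swapAnd]
  constructor
  · intro h f hf s hs; rw [← swapAnd_vars_xor I g f hs]; exact h f hf s hs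
  · intro h f hf s hs; rw [swapAnd_vars_xor I g f hs]; exact h f hf s hs

/-- XOR degrees are unchanged. -/
theorem xpdeg_swapAnd (I : LocalMap 4 n m) (g : Fin m) (E : Finset (Fin m)) (w : Fin n) : xpdeg (swapAnd I g) E w = xpdeg I E w := by
  unfold PstarChordBridgeTools.xpdeg PstarXorElimination.pdeg
  have h0 : ∀ j, (swapAnd I g).vars j 0 = I.vars j 0 := fun j => swapAnd_vars_xor I g j (by decide)
  have h1 : ∀ j, (swapAnd I g).vars j 1 = I.vars j 1 := fun j => swapAnd_vars_xor I g j (by decide)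
  simp only [h0, h1]

/-- Leaf-peelability is unchanged. -/
theorem peelable_swapAnd (I : LocalMap 4 n m) (g : Fin m) (F : Finset (Fin m)) : Peelable (swapAnd I g) F ↔ Peelable I F := by
  unfold PstarChordBridgeCotree.Peelable
  simp only [xpdeg_swapAnd]

/-- **The terminal-core conditions are unchanged.** -/
theorem terminal_swapAnd {I : LocalMap 4 n m} (hI : I.IsPure xorAndPred) (g : Fin m) (r : ℕ) (y : Fin m → Bool) (J₀ : Finset (Fin m))
    (w₁ w₂ : Finset (Fin n) × Finset (Fin m) × Bool) : Terminal (swapAnd I g) r y J₀ w₁ w₂ ↔ Terminal I r y J₀ w₁ w₂ := by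
  unfold PstarCoreBoundTargets.Terminal
  simp only [xorClosed_swapAnd, eval_swapAnd hI, gval_swapAnd]

end Summit.PneNP.PneNP.Theorems.PstarSlotSwap
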